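import Summits.KontsevichZagierPeriods.KontsevichZagierPeriods.Theorems.TerasomaMultiplicationMultiplicationAccessibleBlowupChart
import Mathlib.LinearAlgebra.Matrix.SchurComplement

/-!
# `MultiplicationAccessible` (stmt-KontsevichZagierPeriods-12305), line
`shifted-family-prime-sieve`, stub `blowupChartGen`

General-`p` version (`p = n + 2`) of `blowupChartThree`: the corner blow-up chart of the open cube
`(0,1)^p` as ONE change-of-variables move (Kontsevich–Zagier rule (2), `KZ.changeOfVariablesRel`).
In coordinates `u = (θ₁, …, θ_(n+1), y)` (`θ_i = u (castSucc i)`, `y = u last`) on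
`U = {θ_i > 0, Σθ_i < 1, y > 0, yΘ_k < 1}`, `Θ₀ = 1 − Σθ_i`, `Θ_(i+1) = θ_i`, the chart is
`T(u)_k = 1 − yΘ_k`; for every integrand `G` making both sides integral representations,
`[U, G(T u)·y^(n+1)] ∼ [(0,1)^p, G]`.

* `T` is polynomial, hence a `ℚ`-semialgebraic map (`isSemialgebraicMapOn_chart`);
* its Jacobian is, after matching the output `t_(i+1)` with the input `θ_i` and `t₀` with `y`, the
  block matrix `[[−y·1, −θ], [y…y, −Θ₀]]` (`hasFDerivAt_chart`), whose determinant is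
  `det [[1, −θ], [−1…−1, −Θ₀]] · det [[−y·1, 0], [0, 1]] = (−Θ₀ − Σθ_i)(−y)^(n+1)`, so
  `|det| = y^(n+1)` (`abs_det_chartDeriv`, Schur complement `Matrix.det_fromBlocks_one₁₁` and
  `Matrix.abs_det_submatrix_equiv_equiv` for the relabelling);
* `T` maps `U` into the cube (`chart_mapsTo`), injectively (`chart_injOn`: `y = p − Σ_k T_k`,
  `θ_i = (1 − T_(i+1))/y`) and onto (`chart_surjOn`: the preimage of `t` is
  `θ_i = (1 − t_(i+1))/y`, `y = Σ_k (1 − t_k)`), so `T '' U = (0,1)^p` (`chart_image`).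

As in the `p = 3` file the chart lemmas are stated for arbitrary `Θ`, `T` under their defining
equations and an arbitrary `T'` under `hT'` (the continuous linear map of the Jacobian matrix);
`blowupChartGen` instantiates them. No definitions, no notation.

References: M. Kontsevich, D. Zagier, *Periods* (2001), §1.2 rule (2).
-/

noncomputable section

open MeasureTheory Set
open scoped BigOperators
open Literature.NumberTheory.Transcendental
open Literature.NumberTheory.Transcendental.KZ
open Literature.ModelTheory.ExponentialFields (IsSemialgebraic)
open MvPolynomial (aeval X C)

namespace Summit.KontsevichZagierPeriods.TerasomaMultiplication.MultiplicationAccessible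

namespace BlowupChartGen

section Chart

variable {n : ℕ} {Θ T : (Fin (n + 2) → ℝ) → Fin (n + 2) → ℝ}
  (hΘ0 : ∀ u, Θ u 0 = 1 - ∑ i : Fin (n + 1), u (Fin.castSucc i))
  (hΘs : ∀ u (i : Fin (n + 1)), Θ u i.succ = u (Fin.castSucc i))
  (hT : ∀ u k, T u k = 1 - u (Fin.last (n + 1)) * Θ u k)

include hΘ0 hΘs in
/-- `Σ_k Θ_k = 1`: the `Θ_k` are barycentric coordinates. [folklore] -/
theorem sum_Theta (u : Fin (n + 2) → ℝ) : ∑ k, Θ u k = 1 := by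
  rw [Fin.sum_univ_succ, hΘ0]
  simp [hΘs]

include hΘ0 hT in
/-- The coordinate `t₀ = 1 − yΘ₀` of the chart. [folklore] -/
theorem chart_zero (u : Fin (n + 2) → ℝ) :
    T u 0 = 1 - u (Fin.last (n + 1)) * (1 - ∑ i : Fin (n + 1), u (Fin.castSucc i)) := by
  rw [hT, hΘ0]

include hΘs hT in
/-- The coordinates `t_(i+1) = 1 − yθ_i` of the chart. [folklore] -/
theorem chart_succ (u : Fin (n + 2) → ℝ) (i : Fin (n + 1)) :
    T u i.succ = 1 - u (Fin.last (n + 1)) * u (Fin.castSucc i) := by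
  rw [hT, hΘs]

include hΘ0 hΘs hT in
/-- `Σ_k T_k = p − y` on the nose (`Σ_k Θ_k = 1`). [folklore] -/
theorem sum_chart (u : Fin (n + 2) → ℝ) :
    ∑ k, T u k = ((n:ℝ) + 2) - u (Fin.last (n + 1)) := by
  simp_rw [hT u]
  rw [Finset.sum_sub_distrib, ← Finset.mul_sum, sum_Theta hΘ0 hΘs u]
  simp

include hΘ0 hΘs hT

/-- `T` maps the chart domain `U` into the open cube. [folklore] -/
theorem chart_mapsTo :
    MapsTo T {u : Fin (n + 2) → ℝ | (∀ i : Fin (n + 1), 0 < u (Fin.castSucc i)) ∧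
        ∑ i : Fin (n + 1), u (Fin.castSucc i) < 1 ∧ 0 < u (Fin.last (n + 1)) ∧
        u (Fin.last (n + 1)) * (1 - ∑ i : Fin (n + 1), u (Fin.castSucc i)) < 1 ∧
        ∀ i : Fin (n + 1), u (Fin.last (n + 1)) * u (Fin.castSucc i) < 1}
      {t : Fin (n + 2) → ℝ | ∀ k, t k ∈ Set.Ioo (0:ℝ) 1} := by
  intro u hu k
  obtain ⟨hpos, hsum, hy, hy0, hyi⟩ := hu
  refine Fin.cases ?_ (fun i => ?_) k
  · rw [chart_zero hΘ0 hT]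
    have : 0 < u (Fin.last (n + 1)) * (1 - ∑ i : Fin (n + 1), u (Fin.castSucc i)) :=
      mul_pos hy (by linarith)
    exact ⟨by linarith, by linarith⟩
  · rw [chart_succ hΘs hT]
    have := mul_pos hy (hpos i)
    exact ⟨by linarith [hyi i], by linarith⟩

/-- `T` is injective on the chart domain: `y = p − Σ_k T_k` and then `θ_i = (1 − T_(i+1))/y`.
[folklore] -/
theorem chart_injOn :
    InjOn T {u : Fin (n + 2) → ℝ | (∀ i : Fin (n + 1), 0 < u (Fin.castSucc i)) ∧
        ∑ i : Fin (n + 1), u (Fin.castSucc i) < 1 ∧ 0 < u (Fin.last (n + 1)) ∧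
        u (Fin.last (n + 1)) * (1 - ∑ i : Fin (n + 1), u (Fin.castSucc i)) < 1 ∧
        ∀ i : Fin (n + 1), u (Fin.last (n + 1)) * u (Fin.castSucc i) < 1} := by
  intro u hu u' _ heq
  have hy : 0 < u (Fin.last (n + 1)) := hu.2.2.1
  have hyy : u (Fin.last (n + 1)) = u' (Fin.last (n + 1)) := by
    have e := congrArg (fun t : Fin (n + 2) → ℝ => ∑ k, t k) heq
    simp only [sum_chart hΘ0 hΘs hT] at e
    linarith
  funext l
  refine Fin.lastCases hyy (fun i => ?_) l
  have e := congr_fun heq i.succ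
  rw [chart_succ hΘs hT, chart_succ hΘs hT, ← hyy] at e
  exact mul_left_cancel₀ hy.ne' (by linarith)

/-- `T` maps the chart domain ONTO the open cube: the preimage of `t` is
`θ_i = (1 − t_(i+1))/y`, `y = Σ_k (1 − t_k)`. [folklore] -/
theorem chart_surjOn :
    SurjOn T {u : Fin (n + 2) → ℝ | (∀ i : Fin (n + 1), 0 < u (Fin.castSucc i)) ∧
        ∑ i : Fin (n + 1), u (Fin.castSucc i) < 1 ∧ 0 < u (Fin.last (n + 1)) ∧
        u (Fin.last (n + 1)) * (1 - ∑ i : Fin (n + 1), u (Fin.castSucc i)) < 1 ∧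
        ∀ i : Fin (n + 1), u (Fin.last (n + 1)) * u (Fin.castSucc i) < 1}
      {t : Fin (n + 2) → ℝ | ∀ k, t k ∈ Set.Ioo (0:ℝ) 1} := by
  intro t ht
  set Y : ℝ := ∑ k, (1 - t k) with hY
  have hY0 : 0 < Y := Finset.sum_pos (fun k _ => by linarith [(ht k).2]) Finset.univ_nonempty
  have hYs : Y = (1 - t 0) + ∑ i : Fin (n + 1), (1 - t i.succ) := Fin.sum_univ_succ _
  set u : Fin (n + 2) → ℝ := Fin.snoc (fun i : Fin (n + 1) => (1 - t i.succ) / Y) Y with hu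
  have hul : u (Fin.last (n + 1)) = Y := by simp [hu]
  have huc : ∀ i : Fin (n + 1), u (Fin.castSucc i) = (1 - t i.succ) / Y := fun i => by simp [hu]
  have hus : ∑ i : Fin (n + 1), u (Fin.castSucc i) =
      (∑ i : Fin (n + 1), (1 - t i.succ)) / Y := by
    simp_rw [huc]
    rw [Finset.sum_div]
  have hmul : ∀ a : ℝ, Y * (a / Y) = a := fun a => mul_div_cancel₀ a hY0.ne'
  refine ⟨u, ⟨fun i => ?_, ?_, by rwa [hul], ?_, fun i => ?_⟩, ?_⟩
  · rw [huc]
    exact div_pos (by linarith [(ht i.succ).2]) hY0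
  · rw [hus, div_lt_one hY0, hYs]
    linarith [(ht 0).2]
  · rw [hul, hus, mul_sub, mul_one, hmul, hYs]
    linarith [(ht 0).1]
  · rw [hul, huc, hmul]
    linarith [(ht i.succ).1]
  · funext k
    refine Fin.cases ?_ (fun i => ?_) k
    · rw [chart_zero hΘ0 hT, hul, hus, mul_sub, mul_one, hmul, hYs]
      ring
    · rw [chart_succ hΘs hT, hul, huc, hmul]
      ring

/-- The image of the chart domain under `T` is the open cube (the `r'.domain = T '' r.domain`
side condition of the move). [folklore] -/
theorem chart_image :
    T '' {u : Fin (n + 2) → ℝ | (∀ i : Fin (n + 1), 0 < u (Fin.castSucc i)) ∧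
        ∑ i : Fin (n + 1), u (Fin.castSucc i) < 1 ∧ 0 < u (Fin.last (n + 1)) ∧
        u (Fin.last (n + 1)) * (1 - ∑ i : Fin (n + 1), u (Fin.castSucc i)) < 1 ∧
        ∀ i : Fin (n + 1), u (Fin.last (n + 1)) * u (Fin.castSucc i) < 1} =
      {t : Fin (n + 2) → ℝ | ∀ k, t k ∈ Set.Ioo (0:ℝ) 1} :=
  (chart_surjOn hΘ0 hΘs hT).image_eq_of_mapsTo (chart_mapsTo hΘ0 hΘs hT)

/-- `T` is a `ℚ`-semialgebraic map on every `ℚ`-semialgebraic set: its coordinates are the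
polynomials `1 − X_y(1 − Σ_i X_i)`, `1 − X_y X_i`. [cite: KontsevichZagier2001, §1.2] -/
theorem isSemialgebraicMapOn_chart {σ : Set (Fin (n + 2) → ℝ)} (hσ : IsSemialgebraic ℚ σ) :
    IsSemialgebraicMapOn ℚ σ T := by
  refine (isSemialgebraicMapOn_aeval hσ fun k => (1 : MvPolynomial (Fin (n + 2)) ℚ) -
    X (Fin.last (n + 1)) * Fin.cases (1 - ∑ i : Fin (n + 1), X (Fin.castSucc i))
      (fun i => X (Fin.castSucc i)) k).congr ?_
  intro u _
  funext k
  refine Fin.cases ?_ (fun i => ?_) k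
  · simp only [Fin.cases_zero, chart_zero hΘ0 hT]
    simp [map_sum]
  · simp only [Fin.cases_succ, chart_succ hΘs hT]
    simp

end Chart

section Deriv

variable {n : ℕ} {Θ T : (Fin (n + 2) → ℝ) → Fin (n + 2) → ℝ}
  (hΘ0 : ∀ u, Θ u 0 = 1 - ∑ i : Fin (n + 1), u (Fin.castSucc i))
  (hΘs : ∀ u (i : Fin (n + 1)), Θ u i.succ = u (Fin.castSucc i))
  (hT : ∀ u k, T u k = 1 - u (Fin.last (n + 1)) * Θ u k)
  {J : (Fin (n + 2) → ℝ) → Matrix (Fin (n + 2)) (Fin (n + 2)) ℝ}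
  (hJ : ∀ u, J u = (Matrix.fromBlocks
      ((-u (Fin.last (n + 1))) • (1 : Matrix (Fin (n + 1)) (Fin (n + 1)) ℝ))
      (Matrix.of fun (i : Fin (n + 1)) (_ : Fin 1) => -u (Fin.castSucc i))
      (Matrix.of fun (_ : Fin 1) (_ : Fin (n + 1)) => u (Fin.last (n + 1)))
      (Matrix.of fun (_ _ : Fin 1) => -(1 - ∑ i : Fin (n + 1), u (Fin.castSucc i)))).submatrix
      ((finRotate (n + 2)).symm.trans (finSumFinEquiv (m := n + 1) (n := 1)).symm)
      (finSumFinEquiv (m := n + 1) (n := 1)).symm)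
  {T' : (Fin (n + 2) → ℝ) → (Fin (n + 2) → ℝ) →L[ℝ] (Fin (n + 2) → ℝ)}
  (hT' : ∀ u, T' u = LinearMap.toContinuousLinearMap (Matrix.toLin' (J u)))

/-- The output relabelling of the Jacobian matrix sends the row of `t₀` to the second block.
[folklore] -/
theorem rowEquiv_zero :
    ((finRotate (n + 2)).symm.trans (finSumFinEquiv (m := n + 1) (n := 1)).symm) 0 = Sum.inr 0 := by
  rw [Equiv.trans_apply, show (finRotate (n + 2)).symm 0 = Fin.last (n + 1) from
    (Equiv.symm_apply_eq _).2 finRotate_last.symm, finSumFinEquiv_symm_last]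

/-- The output relabelling of the Jacobian matrix sends the row of `t_(i+1)` to `inl i`.
[folklore] -/
theorem rowEquiv_succ (i : Fin (n + 1)) :
    ((finRotate (n + 2)).symm.trans (finSumFinEquiv (m := n + 1) (n := 1)).symm) i.succ =
      Sum.inl i := by
  rw [Equiv.trans_apply, show (finRotate (n + 2)).symm i.succ = Fin.castSucc i from
    (Equiv.symm_apply_eq _).2 (by rw [finRotate_apply, Fin.coeSucc_eq_succ]),
    finSumFinEquiv_symm_apply_castSucc]

include hJ in
/-- Row `t₀` of the Jacobian: `DT(u)h₀ = y Σ_i h_i − Θ₀ h_y`. [folklore] -/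
theorem mulVec_zero (u h : Fin (n + 2) → ℝ) :
    (J u).mulVec h 0 = u (Fin.last (n + 1)) * ∑ i : Fin (n + 1), h (Fin.castSucc i) -
      (1 - ∑ i : Fin (n + 1), u (Fin.castSucc i)) * h (Fin.last (n + 1)) := by
  rw [hJ]
  simp only [Matrix.mulVec, dotProduct]
  rw [Fin.sum_univ_castSucc (n := n + 1)]
  simp only [Matrix.submatrix_apply, rowEquiv_zero, finSumFinEquiv_symm_apply_castSucc,
    finSumFinEquiv_symm_last, Matrix.fromBlocks_apply₂₁, Matrix.fromBlocks_apply₂₂,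
    Matrix.of_apply]
  rw [Finset.mul_sum]
  ring

include hJ in
/-- Row `t_(i+1)` of the Jacobian: `DT(u)h_(i+1) = −y h_i − θ_i h_y`. [folklore] -/
theorem mulVec_succ (u h : Fin (n + 2) → ℝ) (i : Fin (n + 1)) :
    (J u).mulVec h i.succ =
      -(u (Fin.last (n + 1)) * h (Fin.castSucc i)) - u (Fin.castSucc i) * h (Fin.last (n + 1)) := by
  rw [hJ]
  simp only [Matrix.mulVec, dotProduct]
  rw [Fin.sum_univ_castSucc (n := n + 1)]
  simp only [Matrix.submatrix_apply, rowEquiv_succ, finSumFinEquiv_symm_apply_castSucc,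
    finSumFinEquiv_symm_last, Matrix.fromBlocks_apply₁₁, Matrix.fromBlocks_apply₁₂,
    Matrix.of_apply,
    Matrix.smul_apply, Matrix.one_apply, smul_eq_mul, mul_ite, mul_one, mul_zero, ite_mul, zero_mul,
    Finset.sum_ite_eq, Finset.mem_univ, if_true]
  ring

include hJ hT' in
/-- `|det T'(u)| = y^(n+1)` for `y ≥ 0`: factor the block Jacobian as
`[[1, −θ], [−1…−1, −Θ₀]] · [[−y·1, 0], [0, 1]]`, Schur complement `−Θ₀ − Σθ_i = −1` for the first
factor. [folklore] -/
theorem abs_det_chartDeriv (u : Fin (n + 2) → ℝ) (hy : 0 ≤ u (Fin.last (n + 1))) :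
    |(T' u).det| = u (Fin.last (n + 1)) ^ (n + 1) := by
  rw [hT', LinearMap.det_toContinuousLinearMap, LinearMap.det_toLin', hJ,
    Matrix.abs_det_submatrix_equiv_equiv]
  set y := u (Fin.last (n + 1)) with hy'
  set B : Matrix (Fin (n + 1)) (Fin 1) ℝ := Matrix.of fun i _ => -u (Fin.castSucc i) with hB
  set D : Matrix (Fin 1) (Fin 1) ℝ :=
    Matrix.of fun _ _ => -(1 - ∑ i : Fin (n + 1), u (Fin.castSucc i)) with hD
  set C₀ : Matrix (Fin 1) (Fin (n + 1)) ℝ := Matrix.of fun _ _ => -1 with hC₀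
  have hfac : Matrix.fromBlocks ((-y) • (1 : Matrix (Fin (n + 1)) (Fin (n + 1)) ℝ)) B
      (Matrix.of fun (_ : Fin 1) (_ : Fin (n + 1)) => y) D =
      Matrix.fromBlocks 1 B C₀ D *
        Matrix.fromBlocks ((-y) • (1 : Matrix (Fin (n + 1)) (Fin (n + 1)) ℝ)) 0 0 1 := by
    rw [Matrix.fromBlocks_multiply]
    simp only [Matrix.mul_zero, add_zero, Matrix.mul_one, zero_add, Matrix.mul_smul]
    congr 1
    ext a b
    simp [hC₀]
  have hS : (D - C₀ * B) 0 0 = -1 := by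
    simp only [hD, hC₀, hB, Matrix.sub_apply, Matrix.mul_apply, Matrix.of_apply, neg_mul, one_mul,
      neg_neg]
    ring
  rw [hfac, Matrix.det_mul, Matrix.det_fromBlocks_one₁₁, Matrix.det_fromBlocks_zero₂₁,
    Matrix.det_fin_one, hS, Matrix.det_smul, Matrix.det_one, Matrix.det_one, Fintype.card_fin]
  simp only [mul_one, abs_mul, abs_neg, abs_one, one_mul, abs_pow, abs_of_nonneg hy]

include hΘ0 hΘs hT hJ hT' in
/-- `T` has derivative `T' u` at every point: row by row (`hasFDerivAt_pi''`), product rule for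
the polynomial coordinates. [folklore] -/
theorem hasFDerivAt_chart (u : Fin (n + 2) → ℝ) : HasFDerivAt T (T' u) u := by
  have hTfun : T = fun u k => 1 - u (Fin.last (n + 1)) *
      Fin.cases (1 - ∑ i : Fin (n + 1), u (Fin.castSucc i)) (fun i => u (Fin.castSucc i)) k := by
    funext u k
    refine Fin.cases ?_ (fun i => ?_) k
    · rw [chart_zero hΘ0 hT, Fin.cases_zero]
    · rw [chart_succ hΘs hT, Fin.cases_succ]
  have hl := hasFDerivAt_apply (𝕜 := ℝ) (Fin.last (n + 1)) u
  have hc := fun i : Fin (n + 1) => hasFDerivAt_apply (𝕜 := ℝ) (Fin.castSucc i) u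
  rw [hTfun]
  refine hasFDerivAt_pi'' fun k => ?_
  refine Fin.cases ?_ (fun i => ?_) k
  · simp only [Fin.cases_zero]
    refine ((hl.mul ((HasFDerivAt.fun_sum fun i _ => hc i).const_sub 1)).const_sub 1).congr_fderiv
      (ContinuousLinearMap.ext fun h => ?_)
    simp [hT', Matrix.toLin'_apply, mulVec_zero hJ]
    ring
  · simp only [Fin.cases_succ]
    refine ((hl.mul (hc i)).const_sub 1).congr_fderiv (ContinuousLinearMap.ext fun h => ?_)
    simp [hT', Matrix.toLin'_apply, mulVec_succ hJ]
    ring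

end Deriv

end BlowupChartGen

/-- **Registered sub-goal `blowupChartGen`** (line `shifted-family-prime-sieve` of crux
stmt-KontsevichZagierPeriods-12305). The corner blow-up chart of the open cube `(0,1)^(n+2)`,
`T(u)_k = 1 − yΘ_k` (`Θ₀ = 1 − Σθ_i`, `Θ_(i+1) = θ_i`, `θ_i = u (castSucc i)`, `y = u last`) on
`U = {θ_i > 0, Σθ_i < 1, y > 0, yΘ_k < 1}`, is ONE change-of-variables move
(`KZ.changeOfVariablesRel`, `|det DT| = y^(n+1)`, `T '' U = (0,1)^(n+2)`):
`[U, G(T u)·y^(n+1)] ∼ [(0,1)^(n+2), G]`. [cite: KontsevichZagier2001, §1.2] -/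
theorem blowupChartGen : ∀ (n : ℕ) (x s : ℚ), 0 < x → 0 < s → ∀ (Θ T : (Fin (n + 2) → ℝ) → Fin (n + 2) → ℝ),
    (∀ u, Θ u 0 = 1 - ∑ i : Fin (n + 1), u (Fin.castSucc i)) → (∀ u (i : Fin (n + 1)), Θ u i.succ = u (Fin.castSucc i)) →
    (∀ u k, T u k = 1 - u (Fin.last (n + 1)) * Θ u k) →
    ∀ (G : (Fin (n + 2) → ℝ) → ℝ), (∀ t : Fin (n + 2) → ℝ, G t = (∑ j : Fin (n + 2), (∏ i ∈ Finset.univ.filter (fun i : Fin (n + 2) => i < j), t i) /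
        ((∏ k, t k) ^ (1 / ((n:ℝ) + 2))) ^ (j:ℕ)) / ((n:ℝ) + 2) *
      ∏ k : Fin (n + 2), (t k) ^ ((x:ℝ) + ((k:ℕ):ℝ) / ((n:ℝ) + 2) - 1) * (1 - t k) ^ ((s:ℝ) - 1)) →
    ∀ (rU r₀ : KZ.IntegralRep (n + 2)), rU.domain = {u : Fin (n + 2) → ℝ | (∀ i : Fin (n + 1), 0 < u (Fin.castSucc i)) ∧ ∑ i : Fin (n + 1), u (Fin.castSucc i) < 1 ∧ 0 < u (Fin.last (n + 1)) ∧ u (Fin.last (n + 1)) * (1 - ∑ i : Fin (n + 1), u (Fin.castSucc i)) < 1 ∧ ∀ i : Fin (n + 1), u (Fin.last (n + 1)) * u (Fin.castSucc i) < 1} →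
    Set.EqOn rU.integrand (fun u => G (T u) * (u (Fin.last (n + 1))) ^ (n + 1)) rU.domain →
    r₀.domain = {t : Fin (n + 2) → ℝ | ∀ k, t k ∈ Set.Ioo (0:ℝ) 1} → Set.EqOn r₀.integrand G r₀.domain → KZ.Equivalent rU r₀ := by
  intro n x s _ _ Θ T hΘ0 hΘs hT G _ rU r₀ hrU hrUi hr₀ hr₀i
  -- the Jacobian matrix (block form, relabelled) and its continuous linear map, kept opaque
  obtain ⟨J, hJ⟩ : ∃ J : (Fin (n + 2) → ℝ) → Matrix (Fin (n + 2)) (Fin (n + 2)) ℝ,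
      ∀ u, J u = (Matrix.fromBlocks ((-u (Fin.last (n + 1))) • (1 : Matrix (Fin (n + 1)) (Fin (n + 1)) ℝ))
        (Matrix.of fun (i : Fin (n + 1)) (_ : Fin 1) => -u (Fin.castSucc i))
        (Matrix.of fun (_ : Fin 1) (_ : Fin (n + 1)) => u (Fin.last (n + 1)))
        (Matrix.of fun (_ _ : Fin 1) => -(1 - ∑ i : Fin (n + 1), u (Fin.castSucc i)))).submatrix
        ((finRotate (n + 2)).symm.trans (finSumFinEquiv (m := n + 1) (n := 1)).symm)
        (finSumFinEquiv (m := n + 1) (n := 1)).symm :=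
    ⟨_, fun _ => rfl⟩
  obtain ⟨T', hT'⟩ : ∃ T' : (Fin (n + 2) → ℝ) → (Fin (n + 2) → ℝ) →L[ℝ] (Fin (n + 2) → ℝ),
      ∀ u, T' u = LinearMap.toContinuousLinearMap (Matrix.toLin' (J u)) :=
    ⟨_, fun _ => rfl⟩
  -- the side conditions of the move on `rU.domain = U`
  have hsa : IsSemialgebraicMapOn ℚ rU.domain T :=
    BlowupChartGen.isSemialgebraicMapOn_chart hΘ0 hΘs hT rU.isSemialgebraic_domain
  have hinj : InjOn T rU.domain := hrU ▸ BlowupChartGen.chart_injOn hΘ0 hΘs hT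
  have himage : r₀.domain = T '' rU.domain := by
    rw [hrU, BlowupChartGen.chart_image hΘ0 hΘs hT, hr₀]
  refine changeOfVariablesRel_subset_relations ⟨n + 2, rU, r₀, T, T', hsa,
    fun u _ => (BlowupChartGen.hasFDerivAt_chart hΘ0 hΘs hT hJ hT' u).hasFDerivWithinAt, hinj,
    himage, fun u hu => ?_, rfl⟩
  -- the pull-back identity on `rU.domain`, Jacobian `|det| = y^(n+1)` included
  have hTu : T u ∈ r₀.domain := himage ▸ mem_image_of_mem T hu
  have hy : 0 ≤ u (Fin.last (n + 1)) := by
    rw [hrU] at hu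
    exact hu.2.2.1.le
  rw [hrUi hu, hr₀i hTu, BlowupChartGen.abs_det_chartDeriv hJ hT' u hy]

end Summit.KontsevichZagierPeriods.TerasomaMultiplication.MultiplicationAccessible

end
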